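import Mathlib
import Mathlib.Analysis.SpecialFunctions.Pow.Real
import Mathlib.Analysis.SpecialFunctions.Log.Basic
import Literature.NumberTheory.DiophantineGeometry.Conductor
import Literature.NumberTheory.DiophantineGeometry.MinimalDiscriminant
import Literature.NumberTheory.EllipticCurves.Tamagawa
import HarnessLib.Audit
import Literature.NumberTheory.EllipticCurves.ShafarevichGoodReduction
import Literature.NumberTheory.EllipticCurves.ModularityVersionApProofs
import Literature.NumberTheory.DiophantineGeometry.ConductorRadicalProofs
import HarnessLib

/-!
# SmallTamagawaConjecture — CONJECTURE (obligation of ABC/ABC)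

Unproven conjecture migrated by the gate from `Literature/NumberTheory/EllipticCurves/PastenValuationProduct.lean` (`Literature.NumberTheory.EllipticCurves.SmallTamagawaConjecture`): unproven conjectures are obligations of our
theories, not literature facts (human ruling 2026-08-15). Provenance: PastenShimura2024. Routes use it as a crux item or via
`--conditional-bridge --conditional-on SmallTamagawaConjecture`; a proof goes in the sibling `Theorems/SmallTamagawaConjectureHolds.lean` as `theorem SmallTamagawaConjecture_holds : SmallTamagawaConjecture` so this file stays a conjecture LEAF that Literature/ may import.
-/

namespace Summit.ABC.ABC

open Literature Literature.NumberTheory Literature.NumberTheory.EllipticCurves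
open IsDedekindDomain

/-- **Conjecture (fudge factors are small; folklore) = Pasten, Conj. 1.14** — OPEN, a `Prop`
definition only. "Let `ε > 0`. There is a constant `K_ε` depending only on `ε` such that for all
elliptic curves `E` over `ℚ` we have `Tam(E) < K_ε · N_E^ε`." It follows from Szpiro's conjecture
(de Weger, Hindry: `Tam(E) ≤ d(Δ_E)²`), and Pasten notes it is "not a mild conjecture": it implies
`log Δ_E ≪ N_E^ε`, currently open. Unconditionally one has `pasten_thm_1_15`.
[cite: PastenShimura2024, Conjecture 1.14] -/
@[conjecture] def SmallTamagawaConjecture : Prop :=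
  ∀ ε : ℝ, 0 < ε → ∃ K : ℝ, ∀ (W : WeierstrassCurve ℚ) [W.IsElliptic],
    (W.tamagawaProduct : ℝ) < K * (W.conductorNorm ℤ : ℝ) ^ ε

end Summit.ABC.ABC
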